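import Literature.Geometry.Lorentzian.CoordTensorNorm
import Literature.Geometry.Lorentzian.CoordOrthonormalEigenframe
import Literature.Geometry.Lorentzian.CoordEntropyEvolution
import HarnessLib

/-!
# The linearised `σ₂`-type operator in an orthonormal frame: ellipticity, concavity, bounds

Support file (coordinate language of `CoordCurvature.lean`, at ONE point `x` with `G x` symmetric
positive definite and a `G x`-orthonormal basis `e`) for the `C²` estimate along the
Gursky–Viaclovsky `σ₂`-continuity path
(`Literature.Geometry.Riemannian.gurskyViaclovsky_hessianEstimate_weighted_four`, Gursky–Viaclovsky
2003, Prop. 6; S. Chen 2005, Thm. 1(a), §3). The equation is written through the quadratic form of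
Lorentzian type `P(T) = ½ (c (tr_G T)² − ⟨T, T⟩_G)` (`2σ₂` of the twisted Schouten tensor), whose
linearisation at `W` is the functional `𝔞_W(T) = c tr_G W tr_G T − ⟨W, T⟩_G`.

* frame formulas `mtrAt_eq_sum_frame`, `sum_ginv_mul_eq_sum_frame`, `pairAt_eq_sum_frame`,
  `normSqAt_eq_sum_frame`, `apply_sharpAt_eq_sum_frame`, `gradSqAt_eq_sum_frame`,
  `linearization_metric` (`𝔞_W(G) = (c n − 1) tr W`);
* **`linearization_nonpos`** — ellipticity (Gursky–Viaclovsky 2003, Prop. 1 (ii)): for `W` in the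
  cone `{tr W > 0, |W|² < c (tr W)²}`, `c ≥ 1`, and `T ≤ 0` symmetric, `𝔞_W(T) ≤ 0`;
* **`sum_quadratic_le_of_cone`** — concavity (ibid. Prop. 1 (iii), Gårding's reverse
  Cauchy–Schwarz inequality, summed over a frame):
  `Σ_k [c (tr Y_k)² − |Y_k|²] ≤ (Σ_k 𝔞_W(Y_k)²) / (c (tr W)² − |W|²)`;
* bounds: `abs_apply_frame_le_of_cone` (`|W(e_i,e_j)| ≤ c tr W` on the cone),
  **`abs_linearization_le`** (`|𝔞_W(T)| ≤ 2 c tr W Σ_{ij} |T(e_i,e_j)|`).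

Everything is proved; no definition and no named fact is introduced (the reverse Cauchy–Schwarz
inequality is re-derived here in frame form, cf. `Literature/Geometry/Riemannian/Sigma2ConeConcavity.lean`
for the abstract version, to keep this file's imports inside the coordinate calculus).

## References

* M. J. Gursky, J. A. Viaclovsky, *A fully nonlinear equation on four-manifolds with positive
  scalar curvature*, J. Differential Geom. 63 (2003) 131–154, §2, Prop. 1 (ii)–(iii); §5, proof of
  Prop. 6. [GurskyViaclovsky2003]
* S. Chen, *Local estimates for some fully nonlinear elliptic equations*, IMRN 2005:63, §3.
  [Chen2005]
* B. O'Neill, *Semi-Riemannian geometry*, Academic Press 1983, Ch. 2, Lemma 2.25; Ch. 3,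
  pp. 60–61, 85. [ONeill1983]
-/

noncomputable section

set_option maxSynthPendingDepth 3

open Set Filter ContinuousLinearMap Module Finset
open scoped Topology ContDiff

namespace Literature.Geometry.Lorentzian

namespace MetricCoord

variable {E : Type*} [NormedAddCommGroup E] [NormedSpace ℝ E]
  {ι : Type*} [Fintype ι] [DecidableEq ι] [FiniteDimensional ℝ E]
  {G : E → E →L[ℝ] E →L[ℝ] ℝ} {x : E}

/-! ### Frame formulas for the metric trace, the pairing and the square norm -/

section Frame

variable (e : Basis ι ℝ E) (he : ∀ i j, G x (e i) (e j) = if i = j then 1 else 0)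
include he

/-- **`tr_G T = Σ_i T(e_i,e_i)`** in a `G x`-orthonormal basis. [cite: ONeill1983, Ch. 3, p. 60] -/
theorem mtrAt_eq_sum_frame (hi : (G x).IsInvertible) (T : E →L[ℝ] E →L[ℝ] ℝ) :
    mtrAt G x T = ∑ i, T (e i) (e i) := by
  rw [mtrAt_eq_traceCLM, traceCLM_eq_sum_of_orthonormal e he]
  exact Finset.sum_congr rfl fun i _ ↦ by
    rw [ContinuousLinearMap.comp_apply, apply_sharpAt_apply hi]

/-- **`Σ_{kl} g^{kl} Ψ(b_k,b_l) = Σ_i Ψ(e_i,e_i)`** for a continuous bilinear `Ψ`, any basis `b`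
and any `G x`-orthonormal basis `e` (both are `tr_G Ψ`). [cite: ONeill1983, Ch. 3, p. 60] -/
theorem sum_ginv_mul_eq_sum_frame (hi : (G x).IsInvertible) {κ : Type*} [Fintype κ]
    (b : Basis κ ℝ E) (Ψ : E →L[ℝ] E →L[ℝ] ℝ) :
    ∑ k, ∑ l, ginv G b x k l * Ψ (b k) (b l) = ∑ i, Ψ (e i) (e i) := by
  rw [← mtrAt_eq_sum, mtrAt_eq_sum_frame e he hi]

/-- **`⟨S, T⟩_G = Σ_{ij} S(e_j,e_i) T(e_i,e_j)`** in a `G x`-orthonormal basis (for symmetric `S` or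
`T` this is `Σ S(e_i,e_j)T(e_i,e_j)`). [cite: ONeill1983, Ch. 3, p. 60] -/
theorem pairAt_eq_sum_frame (hi : (G x).IsInvertible) (hs : ∀ v w, G x v w = G x w v)
    (S T : E →L[ℝ] E →L[ℝ] ℝ) :
    pairAt G x S T = ∑ i, ∑ j, S (e j) (e i) * T (e i) (e j) := by
  rw [pairAt_apply, traceCLM_eq_sum_of_orthonormal e he]
  refine Finset.sum_congr rfl fun i _ ↦ ?_
  rw [ContinuousLinearMap.comp_apply, ContinuousLinearMap.comp_apply, apply_sharpAt_apply hi,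
    ContinuousLinearMap.comp_apply, sharpAt_eq_sum_frame e he hi hs (T (e i))]
  simp only [map_sum, map_smul, FunLike.coe_sum, Finset.sum_apply, FunLike.coe_smul,
    Pi.smul_apply, smul_eq_mul]
  exact Finset.sum_congr rfl fun j _ ↦ mul_comm _ _

/-- **`|T|²_G = Σ_{ij} T(e_i,e_j)²`** in a `G x`-orthonormal basis. [cite: ONeill1983, Ch. 3, p. 60] -/
theorem normSqAt_eq_sum_frame (hi : (G x).IsInvertible) (hs : ∀ v w, G x v w = G x w v)
    (T : E →L[ℝ] E →L[ℝ] ℝ) :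
    normSqAt G x T = ∑ i, ∑ j, T (e i) (e j) ^ 2 := by
  have h : normSqAt G x T = pairAt G x T T.flip := by
    rw [normSqAt_eq_traceCLM, pairAt_apply]
  rw [h, pairAt_eq_sum_frame e he hi hs, Finset.sum_comm]
  refine Finset.sum_congr rfl fun i _ ↦ Finset.sum_congr rfl fun j _ ↦ ?_
  rw [ContinuousLinearMap.flip_apply, sq]


omit [FiniteDimensional ℝ E] in
/-- **`φ(♯ψ) = Σ_c ψ(e_c) φ(e_c)`** in a `G x`-orthonormal basis. [cite: ONeill1983, Ch. 2, Lemma 2.25] -/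
theorem apply_sharpAt_eq_sum_frame (hi : (G x).IsInvertible) (hs : ∀ v w, G x v w = G x w v)
    (φ ψ : E →L[ℝ] ℝ) : φ (sharpAt G x ψ) = ∑ c, ψ (e c) * φ (e c) := by
  rw [sharpAt_eq_sum_frame e he hi hs ψ, map_sum]
  exact Finset.sum_congr rfl fun c _ ↦ by rw [map_smul, smul_eq_mul]

omit [FiniteDimensional ℝ E] in
/-- **`|∇f|²_G = Σ_c (df(e_c))²`** in a `G x`-orthonormal basis. [cite: ONeill1983, Ch. 3, p. 85] -/
theorem gradSqAt_eq_sum_frame (hi : (G x).IsInvertible) (hs : ∀ v w, G x v w = G x w v)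
    (f : E → ℝ) : gradSqAt G f x = ∑ c, fderiv ℝ f x (e c) ^ 2 := by
  rw [gradSqAt_apply, apply_sharpAt_eq_sum_frame e he hi hs]
  exact Finset.sum_congr rfl fun c _ ↦ by rw [sq]

/-- **`𝔞_W(G) = (c n − 1) tr_G W`**: the linearised operator on the metric (`tr_G G = n`,
`⟨W, G⟩_G = tr_G W`). [cite: ONeill1983, Ch. 3, pp. 60–61] -/
theorem linearization_metric (hi : (G x).IsInvertible) (c : ℝ) (W : E →L[ℝ] E →L[ℝ] ℝ) :
    c * mtrAt G x W * mtrAt G x (G x) - pairAt G x W (G x) =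
      (c * Fintype.card ι - 1) * mtrAt G x W := by
  rw [pairAt_metric_right hi, mtrAt_eq_sum_frame e he hi (G x)]
  simp only [he, if_true, Finset.sum_const, Finset.card_univ, nsmul_eq_mul, mul_one]
  ring

end Frame

/-! ### The linearised operator `𝔞_W(T) = c tr W tr T − ⟨W, T⟩`: ellipticity and bounds -/

section Linearization

/-- **Ellipticity of the linearised `σ₂`-type operator** (Gursky–Viaclovsky 2003, Prop. 1 (ii):
`T₁(A)`, and `L^t(A)` for `t ≤ 1`, are positive definite on `Γ₂⁺`). For `G x` symmetric positive
definite, `W` symmetric with `tr_G W > 0` and `|W|²_G < c (tr_G W)²`, `c ≥ 1`, and a symmetric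
negative semidefinite `T`: `c tr W tr T − ⟨W, T⟩_G ≤ 0`. Proof in an orthonormal eigenframe of `T`
(`exists_orthonormal_eigenframe`): the pairing is `Σ_i μ_i (c tr W − W(e_i,e_i))` with `μ_i ≤ 0` and
`W(e_i,e_i)² ≤ |W|² < c(tr W)² ≤ (c tr W)²`. [cite: GurskyViaclovsky2003, Prop. 1 (ii)] -/
theorem linearization_nonpos (hs : ∀ v w, G x v w = G x w v) (hpos : ∀ v, v ≠ 0 → 0 < G x v v)
    {W T : E →L[ℝ] E →L[ℝ] ℝ} (hT : ∀ v w, T v w = T w v)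
    (hTn : ∀ v, T v v ≤ 0) {c : ℝ} (hc : 1 ≤ c) (htr : 0 < mtrAt G x W)
    (hcone : normSqAt G x W < c * mtrAt G x W ^ 2) :
    c * mtrAt G x W * mtrAt G x T - pairAt G x W T ≤ 0 := by
  classical
  have hi : (G x).IsInvertible := isInvertible_of_pos hpos
  obtain ⟨e, μ, he, hμ⟩ := exists_orthonormal_eigenframe hs hpos T hT
  set w := mtrAt G x W with hw
  -- frame expressions
  have hTij : ∀ i j, T (e i) (e j) = if i = j then μ i else 0 := fun i j ↦ by
    rw [hμ i (e j), he i j]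
    split_ifs <;> simp
  have htrT : mtrAt G x T = ∑ i, μ i := by
    rw [mtrAt_eq_sum_frame e he hi]
    exact Finset.sum_congr rfl fun i _ ↦ by rw [hTij]; simp
  have hpair : pairAt G x W T = ∑ i, W (e i) (e i) * μ i := by
    rw [pairAt_eq_sum_frame e he hi hs]
    refine Finset.sum_congr rfl fun i _ ↦ ?_
    rw [Finset.sum_eq_single i (fun j _ hji ↦ by rw [hTij, if_neg (Ne.symm hji), mul_zero])
      (fun h ↦ (h (Finset.mem_univ i)).elim), hTij, if_pos rfl]
  have hwsum : w = ∑ i, W (e i) (e i) := by rw [hw, mtrAt_eq_sum_frame e he hi]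
  have hN : normSqAt G x W = ∑ i, ∑ j, W (e i) (e j) ^ 2 := normSqAt_eq_sum_frame e he hi hs W
  -- each diagonal entry is at most `c w`
  have hdiag : ∀ i, W (e i) (e i) ≤ c * w := by
    intro i
    have h1 : W (e i) (e i) ^ 2 ≤ normSqAt G x W := by
      rw [hN]
      calc W (e i) (e i) ^ 2 ≤ ∑ j, W (e i) (e j) ^ 2 :=
            Finset.single_le_sum (f := fun j ↦ W (e i) (e j) ^ 2) (fun j _ ↦ sq_nonneg _)
              (Finset.mem_univ i)
        _ ≤ ∑ i', ∑ j, W (e i') (e j) ^ 2 :=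
            Finset.single_le_sum (f := fun i' ↦ ∑ j, W (e i') (e j) ^ 2)
              (fun i' _ ↦ Finset.sum_nonneg fun j _ ↦ sq_nonneg _) (Finset.mem_univ i)
    have h2 : W (e i) (e i) ^ 2 < (c * w) ^ 2 := by
      calc W (e i) (e i) ^ 2 ≤ normSqAt G x W := h1
        _ < c * w ^ 2 := hcone
        _ ≤ (c * w) ^ 2 := by nlinarith [sq_nonneg w]
    have h3 : 0 ≤ c * w := by positivity
    exact (abs_lt_of_sq_lt_sq' h2 h3).2.le
  -- `μ_i ≤ 0`
  have hμn : ∀ i, μ i ≤ 0 := fun i ↦ by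
    have := hTn (e i)
    rwa [hTij, if_pos rfl] at this
  rw [htrT, hpair, Finset.mul_sum, ← Finset.sum_sub_distrib]
  refine Finset.sum_nonpos fun i _ ↦ ?_
  have : c * w * μ i - W (e i) (e i) * μ i = μ i * (c * w - W (e i) (e i)) := by ring
  rw [this]
  exact mul_nonpos_of_nonpos_of_nonneg (hμn i) (by linarith [hdiag i])

/-- Cauchy–Schwarz for a positive semidefinite symmetric bilinear form (discriminant).
[folklore] -/
private theorem sq_le_mul_self_aux {V : Type*} [AddCommGroup V] [Module ℝ V]
    (ip : V →ₗ[ℝ] V →ₗ[ℝ] ℝ) (hsymm : ∀ X Y, ip X Y = ip Y X)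
    (hpos : ∀ X, 0 ≤ ip X X) (X Y : V) : ip X Y ^ 2 ≤ ip X X * ip Y Y := by
  have h : ∀ t : ℝ, 0 ≤ ip Y Y * (t * t) + 2 * ip X Y * t + ip X X := by
    intro t
    have h1 := hpos (X + t • Y)
    simp only [map_add, map_smul, LinearMap.add_apply, LinearMap.smul_apply, smul_eq_mul] at h1
    rw [hsymm Y X] at h1
    nlinarith [h1]
  have hd := discrim_le_zero h
  rw [discrim] at hd
  nlinarith [hd]

/-- The reverse Cauchy–Schwarz inequality for `Q = c ℓ² − ⟨·,·⟩` with `Q(W) > 0` (the abstract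
statement and its provenance are in `Literature/Geometry/Riemannian/Sigma2ConeConcavity.lean`,
`Sigma2Cone.reverse_cauchy_schwarz`; re-derived to keep the imports light).
[cite: GurskyViaclovsky2003, Prop. 1 (iii)] -/
private theorem reverse_cauchy_schwarz_aux {V : Type*} [AddCommGroup V] [Module ℝ V]
    (ip : V →ₗ[ℝ] V →ₗ[ℝ] ℝ) (hsymm : ∀ X Y, ip X Y = ip Y X)
    (hpos : ∀ X, 0 ≤ ip X X) (ℓ : V →ₗ[ℝ] ℝ) {c : ℝ} (hc : 0 < c)
    {W : V} (hW : ip W W < c * ℓ W ^ 2) (Y : V) :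
    (c * ℓ Y ^ 2 - ip Y Y) * (c * ℓ W ^ 2 - ip W W) ≤ (c * (ℓ W * ℓ Y) - ip W Y) ^ 2 := by
  set QW : ℝ := c * ℓ W ^ 2 - ip W W with hQW
  set B : ℝ := c * (ℓ W * ℓ Y) - ip W Y with hB
  have hQW0 : 0 < QW := by rw [hQW]; linarith
  set Y' : V := QW • Y - B • W with hY'
  have hℓ : ℓ Y' = QW * ℓ Y - B * ℓ W := by
    simp only [hY', map_sub, map_smul, smul_eq_mul]
  have hWY' : ip W Y' = QW * ip W Y - B * ip W W := by
    simp only [hY', map_sub, map_smul, smul_eq_mul]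
  have hY'Y' : ip Y' Y' = QW ^ 2 * ip Y Y - 2 * (QW * B) * ip W Y + B ^ 2 * ip W W := by
    simp only [hY', map_sub, map_smul, LinearMap.sub_apply, LinearMap.smul_apply, smul_eq_mul]
    rw [hsymm Y W]
    ring
  have horth : c * (ℓ W * ℓ Y') = ip W Y' := by
    rw [hℓ, hWY', hB, hQW]
    ring
  have hCS := sq_le_mul_self_aux ip hsymm hpos W Y'
  have hℓW : 0 < ℓ W ^ 2 := by
    by_contra h
    have h0 : ℓ W ^ 2 = 0 := le_antisymm (not_lt.1 h) (sq_nonneg _)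
    rw [h0, mul_zero] at hW
    exact (not_lt.2 (hpos W)) hW
  have hQY' : c * ℓ Y' ^ 2 ≤ ip Y' Y' := by
    have h1 : c ^ 2 * ℓ W ^ 2 * ℓ Y' ^ 2 ≤ c * ℓ W ^ 2 * ip Y' Y' := by
      have h2 : (ip W Y') ^ 2 = c ^ 2 * ℓ W ^ 2 * ℓ Y' ^ 2 := by rw [← horth]; ring
      have h3 : ip W W * ip Y' Y' ≤ c * ℓ W ^ 2 * ip Y' Y' :=
        mul_le_mul_of_nonneg_right hW.le (hpos Y')
      linarith
    have hcl : 0 < c * ℓ W ^ 2 := mul_pos hc hℓW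
    have h4 : c * ℓ W ^ 2 * (c * ℓ Y' ^ 2) ≤ c * ℓ W ^ 2 * ip Y' Y' := by nlinarith
    exact le_of_mul_le_mul_left h4 hcl
  have hexp : c * ℓ Y' ^ 2 - ip Y' Y' = QW * (QW * (c * ℓ Y ^ 2 - ip Y Y) - B ^ 2) := by
    rw [hℓ, hY'Y', hB, hQW]
    ring
  have h5 : QW * (QW * (c * ℓ Y ^ 2 - ip Y Y) - B ^ 2) ≤ 0 := by rw [← hexp]; linarith
  have h6 : QW * (c * ℓ Y ^ 2 - ip Y Y) - B ^ 2 ≤ 0 := by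
    by_contra h
    exact absurd h5 (not_le.2 (mul_pos hQW0 (not_le.1 h)))
  rw [hQW, hB] at h6
  linarith

variable (e : Basis ι ℝ E) (he : ∀ i j, G x (e i) (e j) = if i = j then 1 else 0)
include he

/-- **The traced concavity inequality** (reverse Cauchy–Schwarz, `Sigma2Cone.reverse_cauchy_schwarz`,
summed over an orthonormal frame): for symmetric `W` with `Q = c(tr W)² − |W|² > 0`, `c > 0`, and a
family of bilinear forms `Y_k`,
`Σ_k [c (tr Y_k)² − |Y_k|²] ≤ (Σ_k (c tr W tr Y_k − ⟨W, Y_k⟩)²) / Q`.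
With `Y_k = ∇_{e_k} W` and `c tr W tr Y_k − ⟨W,Y_k⟩ = ∂_k P(W)` this is
`Σ_k F^{ij,rs} W_{ij,k} W_{rs,k} ≤ |∇F|²`-type control of the concavity term (Chen 2005, §3).
[cite: GurskyViaclovsky2003, Prop. 1 (iii)] [cite: Chen2005, §3] -/
theorem sum_quadratic_le_of_cone (hi : (G x).IsInvertible) (hs : ∀ v w, G x v w = G x w v)
    {W : E →L[ℝ] E →L[ℝ] ℝ} (hW : ∀ v w, W v w = W w v) {c : ℝ} (hc : 0 < c)
    (hQ : 0 < c * mtrAt G x W ^ 2 - normSqAt G x W)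
    {κ : Type*} (s : Finset κ) (Y : κ → E →L[ℝ] E →L[ℝ] ℝ) :
    ∑ k ∈ s, (c * mtrAt G x (Y k) ^ 2 - normSqAt G x (Y k)) ≤
      (∑ k ∈ s, (c * mtrAt G x W * mtrAt G x (Y k) - pairAt G x W (Y k)) ^ 2)
        / (c * mtrAt G x W ^ 2 - normSqAt G x W) := by
  classical
  -- the frame inner product and the frame trace as linear maps on bilinear forms
  set ip : (E →L[ℝ] E →L[ℝ] ℝ) →ₗ[ℝ] (E →L[ℝ] E →L[ℝ] ℝ) →ₗ[ℝ] ℝ :=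
    LinearMap.mk₂ ℝ (fun S T ↦ ∑ i, ∑ j, S (e i) (e j) * T (e i) (e j))
      (fun S₁ S₂ T ↦ by
        simp only [_root_.add_apply, add_mul, Finset.sum_add_distrib])
      (fun a S T ↦ by
        simp only [_root_.smul_apply, smul_eq_mul, mul_assoc, Finset.mul_sum])
      (fun S T₁ T₂ ↦ by
        simp only [_root_.add_apply, mul_add, Finset.sum_add_distrib])
      (fun a S T ↦ by
        simp only [_root_.smul_apply, smul_eq_mul, Finset.mul_sum]
        exact Finset.sum_congr rfl fun i _ ↦ Finset.sum_congr rfl fun j _ ↦ by ring) with hip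
  set ℓ : (E →L[ℝ] E →L[ℝ] ℝ) →ₗ[ℝ] ℝ :=
    { toFun := fun T ↦ ∑ i, T (e i) (e i)
      map_add' := fun S T ↦ by simp only [_root_.add_apply, Finset.sum_add_distrib]
      map_smul' := fun a T ↦ by simp only [_root_.smul_apply, smul_eq_mul, Finset.mul_sum, RingHom.id_apply] }
    with hℓ
  have hipa : ∀ S T, ip S T = ∑ i, ∑ j, S (e i) (e j) * T (e i) (e j) := fun S T ↦ rfl
  have hℓa : ∀ T, ℓ T = ∑ i, T (e i) (e i) := fun T ↦ rfl
  have hsymm : ∀ S T, ip S T = ip T S := fun S T ↦ by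
    rw [hipa, hipa]
    exact Finset.sum_congr rfl fun i _ ↦ Finset.sum_congr rfl fun j _ ↦ mul_comm _ _
  have hposip : ∀ T, 0 ≤ ip T T := fun T ↦ by
    rw [hipa]
    exact Finset.sum_nonneg fun i _ ↦ Finset.sum_nonneg fun j _ ↦ by nlinarith
  -- dictionary with `mtrAt`, `pairAt`, `normSqAt` for symmetric forms
  have htr : ∀ T : E →L[ℝ] E →L[ℝ] ℝ, mtrAt G x T = ℓ T := fun T ↦ by
    rw [hℓa, mtrAt_eq_sum_frame e he hi]
  have hpr : ∀ S T : E →L[ℝ] E →L[ℝ] ℝ, (∀ v w, S v w = S w v) → pairAt G x S T = ip S T := by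
    intro S T hS
    rw [hipa, pairAt_eq_sum_frame e he hi hs]
    exact Finset.sum_congr rfl fun i _ ↦ Finset.sum_congr rfl fun j _ ↦ by rw [hS]
  have hnm : ∀ T : E →L[ℝ] E →L[ℝ] ℝ, normSqAt G x T = ip T T := fun T ↦ by
    rw [hipa, normSqAt_eq_sum_frame e he hi hs]
    exact Finset.sum_congr rfl fun i _ ↦ Finset.sum_congr rfl fun j _ ↦ by rw [sq]
  have hWcone : ip W W < c * ℓ W ^ 2 := by rw [← hnm, ← htr]; linarith
  rw [le_div_iff₀ hQ, Finset.sum_mul]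
  refine Finset.sum_le_sum fun k _ ↦ ?_
  have h := reverse_cauchy_schwarz_aux ip hsymm hposip ℓ hc hWcone (Y k)
  rw [← htr, ← htr, ← hnm, ← hnm, ← hpr W (Y k) hW, ← mul_assoc] at h
  exact h


/-- **Entries on the cone**: if `|W|²_G ≤ c (tr_G W)²` with `c ≥ 1`, `tr_G W ≥ 0`, then
`|W(e_i, e_j)| ≤ c tr_G W` in a `G x`-orthonormal basis. [cite: GurskyViaclovsky2003, Prop. 1 (ii)] -/
theorem abs_apply_frame_le_of_cone (hi : (G x).IsInvertible) (hs : ∀ v w, G x v w = G x w v)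
    {W : E →L[ℝ] E →L[ℝ] ℝ} {c : ℝ} (hc : 1 ≤ c) (hw : 0 ≤ mtrAt G x W)
    (hcone : normSqAt G x W ≤ c * mtrAt G x W ^ 2) (i j : ι) :
    |W (e i) (e j)| ≤ c * mtrAt G x W := by
  have h1 : W (e i) (e j) ^ 2 ≤ normSqAt G x W := by
    rw [normSqAt_eq_sum_frame e he hi hs]
    calc W (e i) (e j) ^ 2 ≤ ∑ j', W (e i) (e j') ^ 2 :=
          Finset.single_le_sum (f := fun j' ↦ W (e i) (e j') ^ 2) (fun _ _ ↦ sq_nonneg _)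
            (Finset.mem_univ j)
      _ ≤ ∑ i', ∑ j', W (e i') (e j') ^ 2 :=
          Finset.single_le_sum (f := fun i' ↦ ∑ j', W (e i') (e j') ^ 2)
            (fun _ _ ↦ Finset.sum_nonneg fun _ _ ↦ sq_nonneg _) (Finset.mem_univ i)
  have h2 : W (e i) (e j) ^ 2 ≤ (c * mtrAt G x W) ^ 2 := by
    calc W (e i) (e j) ^ 2 ≤ normSqAt G x W := h1
      _ ≤ c * mtrAt G x W ^ 2 := hcone
      _ ≤ (c * mtrAt G x W) ^ 2 := by nlinarith [sq_nonneg (mtrAt G x W)]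
  exact abs_le_of_sq_le_sq' h2 (by positivity) |>.2 |> fun h ↦
    abs_le.2 ⟨(abs_le_of_sq_le_sq' h2 (by positivity)).1, h⟩

/-- **The linearised operator is bounded by the `ℓ¹` frame norm**: on the cone (`c ≥ 1`,
`tr_G W ≥ 0`, `|W|²_G ≤ c (tr_G W)²`), `|c tr W tr T − ⟨W, T⟩| ≤ 2 c tr W Σ_{ij} |T(e_i, e_j)|` for
every bilinear `T`. [cite: Chen2005, §3] -/
theorem abs_linearization_le (hi : (G x).IsInvertible) (hs : ∀ v w, G x v w = G x w v)
    {W : E →L[ℝ] E →L[ℝ] ℝ} {c : ℝ} (hc : 1 ≤ c) (hw : 0 ≤ mtrAt G x W)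
    (hcone : normSqAt G x W ≤ c * mtrAt G x W ^ 2) (T : E →L[ℝ] E →L[ℝ] ℝ) :
    |c * mtrAt G x W * mtrAt G x T - pairAt G x W T| ≤
      2 * (c * mtrAt G x W) * ∑ i, ∑ j, |T (e i) (e j)| := by
  set w := mtrAt G x W with hw'
  have hcw : 0 ≤ c * w := by positivity
  have hent : ∀ i j, |W (e i) (e j)| ≤ c * w := abs_apply_frame_le_of_cone e he hi hs hc hw hcone
  have htr : |c * w * mtrAt G x T| ≤ c * w * ∑ i, ∑ j, |T (e i) (e j)| := by
    rw [abs_mul, abs_of_nonneg hcw, mtrAt_eq_sum_frame e he hi]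
    refine mul_le_mul_of_nonneg_left ((Finset.abs_sum_le_sum_abs _ _).trans
      (Finset.sum_le_sum fun i _ ↦ ?_)) hcw
    exact Finset.single_le_sum (f := fun j ↦ |T (e i) (e j)|) (fun _ _ ↦ abs_nonneg _)
      (Finset.mem_univ i)
  have hpr : |pairAt G x W T| ≤ c * w * ∑ i, ∑ j, |T (e i) (e j)| := by
    rw [pairAt_eq_sum_frame e he hi hs, Finset.mul_sum]
    refine (Finset.abs_sum_le_sum_abs _ _).trans (Finset.sum_le_sum fun i _ ↦ ?_)
    rw [Finset.mul_sum]
    refine (Finset.abs_sum_le_sum_abs _ _).trans (Finset.sum_le_sum fun j _ ↦ ?_)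
    rw [abs_mul]
    exact mul_le_mul_of_nonneg_right (hent j i) (abs_nonneg _)
  calc |c * w * mtrAt G x T - pairAt G x W T|
      ≤ |c * w * mtrAt G x T| + |pairAt G x W T| := abs_sub _ _
    _ ≤ _ := by linarith

end Linearization

end MetricCoord

end Literature.Geometry.Lorentzian

end
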